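import Literature.MathematicalPhysics.QuantumFieldTheory.Balaban1983to89.B7Prop7Ins
import Literature.MathematicalPhysics.QuantumFieldTheory.Balaban1983to89.B7Prop4GeneralCk

/-!
# `Balaban1983to89.B7Prop7Ck` — T. Bałaban, *Averaging operations for lattice gauge theories*, Commun. Math. Phys. **98** (1985)
17–51 [Balaban1985Averaging]: **PROPOSITION 7** (p. 43), the clause «Proposition 4 holds uniformly in A′» FOR THE PART (134)–(136) OF
PROPOSITION 4 — at the complex background `U′U₀ = e^{A′}U₀` the remainder `C_k(U′U₀, ·)(c)` on the insertion space `𝔸^S` is analytic,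
vanishes at `0` together with its Fréchet derivative (which is the composed linear part `LᵏηQ_k(U′U₀)A(c)`), and its power series begins at
second order; `k`-uniform hypotheses, uniform in `U′`

statement-level skeleton of published theorems with citation tags; proofs where landed; nothing here is a claim about the Yang–Mills mass gap

PDF held: `paper:balaban1985-cmp98-averaging` (journal page = PDF page + 16); pp. 38–39, 43 read on the renders
`b2b-balaban-ref1/pages/1985-cmp98-averaging/1985-cmp98-averaging-p022/p023/p027-x2.png` (AS IMAGES, this unit, 2026-08-21).

CITATION HEADER (lean-in-tree rule).  Cell `lit-balaban`, unit `lit-balaban-r04` (B7 block owner, gen 4) — SKELETON row **`B7.Prop7`**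
(Prop. 7 = «Proposition 4 [= (134)–(136), row B7.Prop4] holds uniformly in A′» + analyticity); the complex-background twin of r04's
`B7Prop4GeneralCk` (p247904), on top of `B7Prop7Levels` (p249465) / `B7Prop7Ins` (p250068).

PRINT.  p. 38: «Proposition 4. … Q_k(U₀, ηA) = Q_k(U₀)A + C_k(U₀, A), (134) |C_k(U₀, A)| < C₂|A|², (135)»; p. 39: «The function C_k can be
decomposed further into a sum of homogeneous polynomials, C_k(U₀, A) = C_k^{(2)}(U₀, A) + C_k^{(3)}(U₀, A) + … . (136)»; p. 43: «Proposition 7.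
For U₀ satisfying (52) and U′ = e^{iηA′}, |A′| < α₁, α₀, α₁ sufficiently small, the function Q_k(U′U₀, ηA) is analytic in complex variables
A′, A, and Proposition 4 holds uniformly in A′.»

WHAT THIS FILE PROVES (kernel, no `sorry`, standard axioms; theorems only), under the DATA of `B7Prop7Levels` for the background perturbation
`B′` (`sup‖B′‖ ≤ b′` with the three `b′`-smallness inequalities) and a polydisc radius `ρ` for the field (`e^{E}(1 + 8C₁′Lᵏρ) ≤ 2`, `2Lᵏρ ≤ c₃/4`):
* §1 `linCovIter_cplx_csmul` — the composed linear part `LʲηQ_j(U′U₀)A` is `ℂ`-homogeneous in `A`, `j ≤ k` (one-step `B7Prop3GeneralTild.linQcov_smul`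
  at the complex level backgrounds `Ũ′ʲ·Ū₀ʲ`, whose block loops are in the disc of the logarithm by `B7Prop7Levels.level_loops_lt_one`).
* §2 `hasDerivAt_logCovIter_cplx_ins_dir` — the directional derivative of `A ↦ Q_k(U′U₀, A)(c)` at `0` in the direction `v ∈ 𝔸^S` is
  `LᵏηQ_k(U′U₀)v(c)`, from (130) for `U′U₀` along the complex line `t ↦ tv` (`B7Prop7Levels.prop7_prop4_uniform`).
* §3 **`hasFDerivAt_logCovIter_cplx_ins`** — (134) IN FRÉCHET FORM AT `U′U₀`: `A ↦ Q_k(U′U₀, A)(c)` is Fréchet-differentiable at `0` on `𝔸^S` with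
  derivative the continuous linear form `A ↦ LᵏηQ_k(U′U₀)A(c)` (`clm_linCovIter_cplx_ins`); existence by `B7Prop7Levels.prop7_analyticAt`.
* §4 **`prop7_Ck_ins`**, **`prop7_Ck_powerSeries`** — (136) AT `U′U₀`: `C_k(U′U₀, ·)(c) = Q_k − LᵏηQ_k(U′U₀)·` is analytic on a neighbourhood of
  every point of the polydisc `{∀ b, ‖A_b‖ < ρ}`, `C_k(U′U₀, 0)(c) = 0`, `D C_k(U′U₀, ·)(c)(0) = 0`, and it has a power series at `0` whose terms of
  order `0` and `1` vanish — with the SAME data for every `U′ = e^{B′}` in the `b′`-regime («uniformly in A′»).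
HONEST DIVERGENCES (located): as in `B7Prop7Levels` / `B7Prop7Ins` (explicit `d`-dependent thresholds as admissible witnesses of «sufficiently
small»; `c₃/4`; `C₁′ = 16C₁`; `η`, `i` absorbed; global objects on `ℤᵈ`); the homogeneous polynomials `C_k^{(m)}` are the terms of the
`FormalMultilinearSeries` (Mathlib), not named individually.
REUSED BY NAME: `B7Prop4GeneralCk.logCovIter_zero_field`, `B7Prop3GeneralTild.linQcov_smul`, `B7Prop7Levels.prop7_prop4_uniform / prop7_analyticAt /
level_loops_lt_one / linCovIter_succ_mul_background`, `B7Prop7Ins.smallness7_mono`, `B7Prop3Flat.insCfg / insCfg_smul / insCfg_zero / analyticAt_insCfg /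
norm_insCfg_le`, `B7Prop4Flat.isOpen_polydisc`.
Unit `lit-balaban-r04` (gen 4), 2026-08-21.

[cite: Balaban1985Averaging, Proposition 7 p.43, Proposition 4 (134)–(136) pp.38–39]
-/

noncomputable section

open scoped BigOperators
open NormedSpace Metric Set Finset

namespace Literature.MathematicalPhysics.QuantumFieldTheory.Balaban1983to89.B7Prop7Ck

open B7Prop1Explicit B7Prop2Explicit B7Prop3Flat MatrixLog B7Eq92Concrete B7Prop3GeneralAnalytic B7Prop3GeneralLinear
  B7Prop4GeneralLevels B7Prop7OneStep B7Prop7Levels B7Prop7Ins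
open B7Prop3GeneralTild (linQcov_smul)
open B7Prop4GeneralCk (logCovIter_zero_field)

-- `Site` alone would resolve to the torus sites of `Setup.lean`; re-export the `ℤ^d` sites of `B7Prop1Explicit`.
export B7Prop1Explicit (Site)

variable {d : ℕ}

variable {𝔸 : Type*} [NormedRing 𝔸] [NormedAlgebra ℂ 𝔸] [CompleteSpace 𝔸] [NormOneClass 𝔸]

section Data

variable (L : ℕ) (hL : 2 ≤ L) {G : Subgroup 𝔸ˣ} (hG : AvgClosed d L G) (k : ℕ)
  (U₀ : Site d → Fin d → 𝔸ˣ) (hU₀ : ∀ x κ, U₀ x κ ∈ G) {α₀ : ℝ} (hα : 0 < α₀)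
  (hα3 : C0 d * α₀ ≤ 1 / 3) (hα8 : 8 * α₀ ≤ c2' d L) (h52 : pdev U₀ < α₀ * (((L : ℝ) ^ k)⁻¹) ^ 2)
  (B' : Site d → Fin d → 𝔸) {b' : ℝ} (hb' : 0 ≤ b') (hB' : ∀ x κ, ‖B' x κ‖ ≤ b')
  (hsmall' : Real.exp (4 * (800 * ((d : ℝ) + 1) ^ 2 * ((d : ℝ) + 4)) * α₀)
    * (1 + 8 * (131072 * ((d : ℝ) + 1) ^ 2) * ((L : ℝ) ^ k * b')) ≤ 2)
  (hc₃' : 2 * ((L : ℝ) ^ k * b') ≤ c3 d L) (hb'1 : 409600 * ((d : ℝ) + 1) ^ 2 * ((L : ℝ) ^ k * b') ≤ 1)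
  {ρ : ℝ} (hρ : 0 < ρ)
  (hρsmall : Real.exp (4480 * ((d : ℝ) + 1) ^ 2 * ((d : ℝ) + 4) * α₀ + 240000 * ((d : ℝ) + 1) ^ 3 * ((L : ℝ) ^ k * b'))
    * (1 + 8 * (2097152 * ((d : ℝ) + 1) ^ 2) * ((L : ℝ) ^ k * ρ)) ≤ 2)
  (hρc₃ : 2 * ((L : ℝ) ^ k * ρ) ≤ c3 d L / 4)

/-! ## §1 The `ℂ`-homogeneity of the composed linear part at the complex background -/

include hL hG hU₀ hα hα3 hα8 h52 hb' hB' hsmall' hc₃' hb'1 in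
/-- **The composed linear part `LʲηQ_j(U′U₀)A` is `ℂ`-homogeneous in `A`, `j ≤ k`** — a composite of the `ℂ`-linear one-step parts «L(Q(V₀)A)»
(`B7Prop3GeneralTild.linQcov_smul`) at the complex level backgrounds `Ũ′ʲ·Ū₀ʲ` (`B7Prop7Levels.linCovIter_succ_mul_background`), whose domain
condition — the block loops in `|W − 1| < 1` — is `B7Prop7Levels.level_loops_lt_one`. [cite: Balaban1985Averaging, Proposition 7 p.43, p.38 (before (130)), (125) p.36] -/
theorem linCovIter_cplx_csmul (c : ℂ) (A : Site d → Fin d → 𝔸) :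
    ∀ j ≤ k, linCovIter L (expCfg B' * U₀) (c • A) j = c • linCovIter L (expCfg B' * U₀) A j := by
  intro j
  induction j with
  | zero => intro _; rfl
  | succ j ih =>
    intro hjk
    have hj : j < k := Nat.lt_of_succ_le hjk
    funext z κ
    have hW := level_loops_lt_one L hL hG k U₀ hU₀ hα hα3 hα8 h52 B' hb' hB' hsmall' hc₃' hb'1 hj ((L : ℤ) • z) κ
    rw [linCovIter_succ_mul_background, ih hj.le, linQcov_smul L _ c _ _ κ hW, Pi.smul_apply, Pi.smul_apply,
      linCovIter_succ_mul_background]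

/-! ## §2 The directional derivative of `A ↦ Q_k(U′U₀, A)(c)` at `0` -/

include hL hG hU₀ hα hα3 hα8 h52 hb' hB' hsmall' hc₃' hb'1 hρ hρsmall hρc₃ in
/-- **DIRECTIONAL COMPLEX DERIVATIVE of `A ↦ Q_k(U′U₀, A)(c)` at `A = 0` on `𝔸^S` in the direction `v`** (the differential (137) at `A = 0`), AT
THE COMPLEX BACKGROUND `U′U₀ = e^{B′}U₀`: it equals the composed linear part `LᵏηQ_k(U′U₀)v(c) = linCovIter L (e^{B′}U₀) (insCfg S v) k c`, from the
quadratic bound (130) for `U′U₀` along the complex line `t ↦ tv` (`B7Prop7Levels.prop7_prop4_uniform` (i): `‖Q_k − LᵏηQ_k(U′U₀)(tv)‖ ≤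
8C₁′e^{E}(Lᵏ|t|‖v‖)²` for `|t|‖v‖ ≤ ρ`) and the homogeneity `linCovIter_cplx_csmul` — uniformly in `U′`.
[cite: Balaban1985Averaging, Proposition 7 p.43, (137) p.39, (130) p.38, (134) p.38] -/
theorem hasDerivAt_logCovIter_cplx_ins_dir (S : Finset (Site d × Fin d)) (z : Site d) (κ : Fin d) (v : S → 𝔸) :
    HasDerivAt (fun t : ℂ => logCovIter L (expCfg B' * U₀) (insCfg S (t • v)) k z κ)
      (linCovIter L (expCfg B' * U₀) (insCfg S v) k z κ) 0 := by
  set K : ℝ := 8 * (2097152 * ((d : ℝ) + 1) ^ 2)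
    * Real.exp (4480 * ((d : ℝ) + 1) ^ 2 * ((d : ℝ) + 4) * α₀ + 240000 * ((d : ℝ) + 1) ^ 3 * ((L : ℝ) ^ k * b'))
    with hK_def
  have hK0 : 0 ≤ K := by positivity
  rw [hasDerivAt_iff_isLittleO_nhds_zero]
  have h0 : logCovIter L (expCfg B' * U₀) (insCfg S ((0 : ℂ) • v)) k z κ = 0 := by
    rw [zero_smul, insCfg_zero, logCovIter_zero_field L (expCfg B' * U₀) k]; rfl
  refine (Asymptotics.IsBigO.of_bound (K * ((L : ℝ) ^ k * ‖v‖) ^ 2) ?_).trans_isLittleO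
    (Asymptotics.isLittleO_pow_id (one_lt_two))
  rw [Metric.eventually_nhds_iff]
  refine ⟨ρ / (‖v‖ + 1), by positivity, fun h hh => ?_⟩
  rw [dist_zero_right] at hh
  -- the smallness at `b = ‖h‖‖v‖ ≤ ρ`
  have hb : ‖h‖ * ‖v‖ ≤ ρ := by
    have hv1 : (0 : ℝ) < ‖v‖ + 1 := by positivity
    have h1 : ‖h‖ * (‖v‖ + 1) ≤ ρ := ((lt_div_iff₀ hv1).1 hh).le
    nlinarith [norm_nonneg h, norm_nonneg v]
  obtain ⟨-, -, -, hs, hc⟩ := smallness7_mono (d := d) (L := L) (k := k) (α₀ := α₀) le_rfl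
    (mul_nonneg (norm_nonneg h) (norm_nonneg v)) hb hsmall' hc₃' hb'1 hρsmall hρc₃
  have hbnd : ∀ x κ', ‖insCfg S (h • v) x κ'‖ ≤ ‖h‖ * ‖v‖ := fun x κ' =>
    (norm_insCfg_le S (h • v) x κ').trans (norm_smul h v).le
  have hE := (prop7_prop4_uniform L hL hG k U₀ hU₀ hα hα3 hα8 h52 B' hb' hB' hsmall' hc₃' hb'1 (insCfg S (h • v))
    (by positivity) hbnd hs hc k le_rfl).1
  have hlin : h • linCovIter L (expCfg B' * U₀) (insCfg S v) k z κ
      = linCovIter L (expCfg B' * U₀) (insCfg S (h • v)) k z κ := by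
    rw [insCfg_smul, linCovIter_cplx_csmul L hL hG k U₀ hU₀ hα hα3 hα8 h52 B' hb' hB' hsmall' hc₃' hb'1 h (insCfg S v) k le_rfl,
      Pi.smul_apply, Pi.smul_apply]
  rw [zero_add, h0, sub_zero, hlin, norm_pow]
  calc ‖logCovIter L (expCfg B' * U₀) (insCfg S (h • v)) k z κ - linCovIter L (expCfg B' * U₀) (insCfg S (h • v)) k z κ‖
      ≤ K * ((L : ℝ) ^ k * (‖h‖ * ‖v‖)) ^ 2 := by rw [hK_def]; exact hE z κ
    _ = K * ((L : ℝ) ^ k * ‖v‖) ^ 2 * ‖h‖ ^ 2 := by ring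

/-! ## §3 (134) in Fréchet form at the complex background -/

include hL hG hU₀ hα hα3 hα8 h52 hb' hB' hsmall' hc₃' hb'1 hρ hρsmall hρc₃ in
/-- **(134) IN FRÉCHET FORM AT THE COMPLEX BACKGROUND `U′U₀`**: on `𝔸^S` the map `A ↦ Q_k(U′U₀, A)(c)` is Fréchet-differentiable at `A = 0`
and its derivative there is the continuous linear form `A ↦ LᵏηQ_k(U′U₀)A(c)` — «Q_k(U′U₀, ηA) = Q_k(U′U₀)A + C_k(U′U₀, A)» ((134) read at
`U′U₀`, p. 43 «Proposition 4 holds uniformly in A′»).  Existence from analyticity at `0` (`B7Prop7Levels.prop7_analyticAt`), identification by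
uniqueness of the directional derivatives (§2). [cite: Balaban1985Averaging, Proposition 7 p.43, (134) p.38] -/
theorem hasFDerivAt_logCovIter_cplx_ins (S : Finset (Site d × Fin d)) (z : Site d) (κ : Fin d) :
    ∃ Λ : (S → 𝔸) →L[ℂ] 𝔸,
      HasFDerivAt (fun a : S → 𝔸 => logCovIter L (expCfg B' * U₀) (insCfg S a) k z κ) Λ 0 ∧
        ∀ v, Λ v = linCovIter L (expCfg B' * U₀) (insCfg S v) k z κ := by
  set f : (S → 𝔸) → 𝔸 := fun a => logCovIter L (expCfg B' * U₀) (insCfg S a) k z κ with hf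
  have han : AnalyticAt ℂ f 0 := by
    obtain ⟨-, -, -, hs, hc⟩ := smallness7_mono (d := d) (L := L) (k := k) (α₀ := α₀) le_rfl
      (norm_nonneg (0 : S → 𝔸)) (show ‖(0 : S → 𝔸)‖ ≤ ρ by rw [norm_zero]; exact hρ.le) hsmall' hc₃' hb'1 hρsmall hρc₃
    exact prop7_analyticAt L hL hG k U₀ hU₀ hα hα3 hα8 h52 (fun _ : S → 𝔸 => B') (fun x κ' => analyticAt_const)
      hb' hB' hsmall' hc₃' hb'1 (fun a : S → 𝔸 => insCfg S a) (fun x κ' => analyticAt_insCfg S x κ' 0) (norm_nonneg _)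
      (fun x κ' => norm_insCfg_le S 0 x κ') hs hc k le_rfl z κ
  have hF : HasFDerivAt f (fderiv ℂ f 0) 0 := han.differentiableAt.hasFDerivAt
  refine ⟨fderiv ℂ f 0, hF, fun v => ?_⟩
  have hg : HasDerivAt (fun t : ℂ => t • v) v 0 := by
    simpa using (hasDerivAt_id (0 : ℂ)).smul_const v
  have hF' : HasFDerivAt f (fderiv ℂ f 0) ((0 : ℂ) • v) := by rwa [zero_smul]
  have h1 : HasDerivAt (f ∘ fun t : ℂ => t • v) (fderiv ℂ f 0 v) 0 := hF'.comp_hasDerivAt (0 : ℂ) hg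
  exact h1.unique (hasDerivAt_logCovIter_cplx_ins_dir L hL hG k U₀ hU₀ hα hα3 hα8 h52 B' hb' hB' hsmall' hc₃' hb'1 hρ
    hρsmall hρc₃ S z κ v)

include hL hG hU₀ hα hα3 hα8 h52 hb' hB' hsmall' hc₃' hb'1 hρ hρsmall hρc₃ in
/-- **`A ↦ LᵏηQ_k(U′U₀)A(c)` on `𝔸^S` IS a continuous linear form** («the operator Q_k», p. 38, at the background `U′U₀`): there is a continuous
`ℂ`-linear `Λ : 𝔸^S → 𝔸` with `Λ a = linCovIter L (e^{B′}U₀) (insCfg S a) k c` for every `a` (the Fréchet derivative of §3).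
[cite: Balaban1985Averaging, Proposition 7 p.43, p.38 (before (130)), (134) p.38] -/
theorem clm_linCovIter_cplx_ins (S : Finset (Site d × Fin d)) (z : Site d) (κ : Fin d) :
    ∃ Λ : (S → 𝔸) →L[ℂ] 𝔸, ∀ a, Λ a = linCovIter L (expCfg B' * U₀) (insCfg S a) k z κ := by
  obtain ⟨Λ, -, hΛ⟩ := hasFDerivAt_logCovIter_cplx_ins L hL hG k U₀ hU₀ hα hα3 hα8 h52 B' hb' hB' hsmall' hc₃' hb'1 hρ
    hρsmall hρc₃ S z κ
  exact ⟨Λ, hΛ⟩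

/-! ## §4 (136) at the complex background: the remainder begins at second order -/

include hL hG hU₀ hα hα3 hα8 h52 hb' hB' hsmall' hc₃' hb'1 hρ hρsmall hρc₃ in
/-- **THE REMAINDER `C_k(U′U₀, A) := Q_k(U′U₀, A) − LᵏηQ_k(U′U₀)A` ON `𝔸^S` — (136) begins at second order, AT THE COMPLEX BACKGROUND**:
`A ↦ C_k(U′U₀, A)(c)` is analytic on a neighbourhood of every point of the open polydisc `{∀ b ∈ S, ‖A_b‖ < ρ}`, `C_k(U′U₀, 0)(c) = 0`, and its
Fréchet derivative at `A = 0` VANISHES — p. 39 «C_k(U₀, A) = C_k^{(2)}(U₀, A) + C_k^{(3)}(U₀, A) + …  (136)» read at `U′U₀` (no terms of order `0`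
and `1`; with the bound `‖C_k‖ ≤ 8C₁′e^{E}(Lᵏb)²` of `B7Prop7Levels.prop7_prop4_uniform`, constants independent of `U′`).
[cite: Balaban1985Averaging, Proposition 7 p.43, (134)–(135) p.38, (136) p.39] -/
theorem prop7_Ck_ins (S : Finset (Site d × Fin d)) (z : Site d) (κ : Fin d) :
    AnalyticOnNhd ℂ (fun a : S → 𝔸 =>
        logCovIter L (expCfg B' * U₀) (insCfg S a) k z κ - linCovIter L (expCfg B' * U₀) (insCfg S a) k z κ)
        {a | ∀ s, ‖a s‖ < ρ} ∧
      logCovIter L (expCfg B' * U₀) (insCfg S (0 : S → 𝔸)) k z κ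
          - linCovIter L (expCfg B' * U₀) (insCfg S (0 : S → 𝔸)) k z κ = 0 ∧
      HasFDerivAt (fun a : S → 𝔸 =>
        logCovIter L (expCfg B' * U₀) (insCfg S a) k z κ - linCovIter L (expCfg B' * U₀) (insCfg S a) k z κ)
        (0 : (S → 𝔸) →L[ℂ] 𝔸) 0 := by
  obtain ⟨Λ, hF, hΛ⟩ := hasFDerivAt_logCovIter_cplx_ins L hL hG k U₀ hU₀ hα hα3 hα8 h52 B' hb' hB' hsmall' hc₃' hb'1 hρ
    hρsmall hρc₃ S z κ
  have hlinfun : (fun a : S → 𝔸 => linCovIter L (expCfg B' * U₀) (insCfg S a) k z κ) = fun a => Λ a :=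
    funext fun a => (hΛ a).symm
  refine ⟨?_, ?_, ?_⟩
  · intro a ha
    have hna : ‖a‖ < ρ := (pi_norm_lt_iff hρ).2 ha
    obtain ⟨-, -, -, hs, hc⟩ := smallness7_mono (d := d) (L := L) (k := k) (α₀ := α₀) le_rfl (norm_nonneg a) hna.le
      hsmall' hc₃' hb'1 hρsmall hρc₃
    have hlog : AnalyticAt ℂ (fun a : S → 𝔸 => logCovIter L (expCfg B' * U₀) (insCfg S a) k z κ) a :=
      prop7_analyticAt L hL hG k U₀ hU₀ hα hα3 hα8 h52 (fun _ : S → 𝔸 => B') (fun x κ' => analyticAt_const)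
        hb' hB' hsmall' hc₃' hb'1 (fun a' : S → 𝔸 => insCfg S a') (fun x κ' => analyticAt_insCfg S x κ' a) (norm_nonneg a)
        (fun x κ' => norm_insCfg_le S a x κ') hs hc k le_rfl z κ
    have hlin : AnalyticAt ℂ (fun a : S → 𝔸 => linCovIter L (expCfg B' * U₀) (insCfg S a) k z κ) a := by
      rw [hlinfun]; exact Λ.analyticAt a
    exact hlog.sub hlin
  · rw [← hΛ 0, map_zero, sub_zero, insCfg_zero, logCovIter_zero_field L (expCfg B' * U₀) k]; rfl
  · have hG' : HasFDerivAt (fun a : S → 𝔸 => linCovIter L (expCfg B' * U₀) (insCfg S a) k z κ) Λ 0 := by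
      rw [hlinfun]; exact Λ.hasFDerivAt
    have h := hF.sub hG'
    rwa [sub_self] at h

include hL hG hU₀ hα hα3 hα8 h52 hb' hB' hsmall' hc₃' hb'1 hρ hρsmall hρc₃ in
/-- **(136) AT THE COMPLEX BACKGROUND AS A STATEMENT ABOUT THE POWER SERIES**: `C_k(U′U₀, ·)(c)` has a power-series expansion at `A = 0` on
`𝔸^S`, `C_k(U′U₀, A)(c) = Σ_n p_n(A, …, A)` (`p_n(A, …, A)` = the homogeneous polynomial `C_k^{(n)}(U′U₀, A)` of degree `n`), and its terms of order
`0` and `1` vanish: `p₀ = 0`, `p₁ = 0` — «C_k = C_k^{(2)} + C_k^{(3)} + …» (136), for every `U′ = e^{B′}` in the displayed regime («Proposition 4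
holds uniformly in A′»). [cite: Balaban1985Averaging, Proposition 7 p.43, (136) p.39] -/
theorem prop7_Ck_powerSeries (S : Finset (Site d × Fin d)) (z : Site d) (κ : Fin d) :
    ∃ p : FormalMultilinearSeries ℂ (S → 𝔸) 𝔸,
      HasFPowerSeriesAt (fun a : S → 𝔸 =>
          logCovIter L (expCfg B' * U₀) (insCfg S a) k z κ - linCovIter L (expCfg B' * U₀) (insCfg S a) k z κ) p 0 ∧
        p 0 = 0 ∧ p 1 = 0 := by
  obtain ⟨hAn, h0, hD⟩ := prop7_Ck_ins L hL hG k U₀ hU₀ hα hα3 hα8 h52 B' hb' hB' hsmall' hc₃' hb'1 hρ hρsmall hρc₃ S z κ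
  obtain ⟨p, hp⟩ := hAn 0 fun s => by simpa using hρ
  refine ⟨p, hp, ?_, ?_⟩
  · ext v
    rw [hp.coeff_zero v]
    simpa using h0
  · have h1 := hp.fderiv_eq
    rw [hD.fderiv] at h1
    exact (continuousMultilinearCurryFin1 ℂ (S → 𝔸) 𝔸).map_eq_zero_iff.1 h1.symm

end Data

end Literature.MathematicalPhysics.QuantumFieldTheory.Balaban1983to89.B7Prop7Ck

end
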